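import Summits.NavierStokesRegularity.NavierStokesRegularity.Theorems.AxisymmetricExtremalityAxisymmetricKatoGlobalStubSeregin2020TypeIILemma22ParabolicBumps
import Summits.NavierStokesRegularity.NavierStokesRegularity.Theorems.AxisymmetricExtremalityAxisymmetricKatoGlobalStubSeregin2020TypeIILemma22InvCylRadius
import HarnessLib

/-!
# Seregin 2020, Lemma 2.2 (after Nazarov–Uraltseva 2012): integral bounds for one parabolic
# bump — the «capacity» of a centred parabolic cylinder against the very weak form

Helper toward the stub `stub_seregin2020TypeII` of the crux `AxisymmetricKatoGlobal` (= the named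
fact `Literature.Analysis.FluidPDE.Seregin2020_axisymmetricSingularPoint_typeII`, G. Seregin,
Anal. Math. Phys. 10 (2020) Paper 46 = arXiv:2006.04140, Thm 2.1), reduced in the tree to the
corrected Lemma 2.2 (`hWH′`; Nazarov–Uraltseva 2012, Lemma 4.2 for the class 𝒱). The very weak
form (N–U (4.5), the tree's `veryWeak_supersolution_axis_lowerBound`) is tested against
`η₀ · G(∑ᵢ ψᵢ)` where the parabolic bumps `ψᵢ` (sibling `…Lemma22ParabolicBumps`) excise the
`𝒫¹`-null singular set `S` of the class 𝒱 (Seregin 2020, class 𝒱 (i)); the excision costs,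
per bump of radius `r < 1`, the integrals bounded here, all `O(r)` (in fact `O(r³)` or better):
for `ψ(t,x) = cutoff (r²) (t - t₀) · cutoff r (x - x₀)`,

* `parabolicBump_formulas` — `∂ₜψ = (cutoff r²)'(t-t₀) · cutoff r (x-x₀)`,
  `D_xψ = cutoff r² (t-t₀) • D(cutoff r)(x-x₀)`, `Δ_xψ = cutoff r² (t-t₀) · Δ(cutoff r)(x-x₀)`,
  whence joint continuity of the three derivative fields and their vanishing off the box
  `[t₀-2r², t₀+2r²] × B̄(x₀, 2r)`;
* `volume_parabolicBox_le` — `|box| ≤ 135 r⁵`; `volume_axisTrace_parabolicBox_le` — the trace of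
  the box on the axis plane `{(t, x₃)}` has area `≤ 16 r³`;
* `lintegral_inv_cylRadius_parabolicBox_le` — `∫∫_box ϱ⁻¹ ≤ C r⁴`;
* `integral_abs_timeDeriv_bump_le`, `integral_norm_fderiv_bump_le`, `integral_abs_laplacian_bump_le`,
  `integral_inv_cylRadius_mul_norm_fderiv_bump_le` — `∫∫|∂ₜψ|, ∫∫|Δψ| ≤ 135A r³`,
  `∫∫‖Dψ‖ ≤ 135A r⁴`, `∫∫ ϱ⁻¹‖Dψ‖ ≤ C A r³`;
* `lintegral_norm_mul_norm_fderiv_bump_le` — `∫∫_K ‖U‖ ‖Dψ‖ ≤ 135^{2/3} A ‖U‖_{L³(K)} r²`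
  (Hölder `L³ × L^{3/2}` on the box).

## References

* G. Seregin, Anal. Math. Phys. 10 (2020), Paper 46 = arXiv:2006.04140, Lemma 2.2, class 𝒱 (i)
  (arXiv p. 8). [Seregin2020]
* A. I. Nazarov, N. N. Uraltseva, St. Petersburg Math. J. 23 (2012) 93–115 = arXiv:1011.1888,
  proof of Lemma 4.2, (4.5)–(4.6). [NazarovUraltseva2012]
-/

-- the problem directory repeats the summit name (D-0017); core's `dupNamespace` linter fires
set_option linter.dupNamespace false

noncomputable section

open MeasureTheory Set Function Filter Topology TopologicalSpace Metric
open scoped NNReal ENNReal InnerProductSpace Laplacian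

namespace Summit.NavierStokesRegularity.NavierStokesRegularity.Theorems.AxisymmetricKatoGlobal.EulerScaling

open Literature.Analysis.FluidPDE

/-! ### Formulas for the derivatives of a parabolic bump -/

/-- **Derivatives of a parabolic bump** `ψ(t,x) = cutoff (r²) (t - t₀) · cutoff r (x - x₀)`:
`∂ₜψ(t,x) = (cutoff r²)'(t - t₀) cutoff r (x - x₀)`, `D(ψ(t,·))(x) = cutoff r² (t-t₀) • D(cutoff r)(x - x₀)`,
`Δ(ψ(t,·))(x) = cutoff r² (t-t₀) · (Δ cutoff r)(x - x₀)`. [folklore] -/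
theorem parabolicBump_formulas {r t₀ : ℝ} {x₀ : EuclideanSpace ℝ (Fin 3)}
    {ψ : ℝ → EuclideanSpace ℝ (Fin 3) → ℝ}
    (hψ : ∀ t x, ψ t x = cutoff (r ^ 2) (t - t₀) * cutoff r (x - x₀)) (t : ℝ) (x : EuclideanSpace ℝ (Fin 3)) :
    deriv (fun s => ψ s x) t = deriv (cutoff (r ^ 2)) (t - t₀) * cutoff r (x - x₀) ∧
    fderiv ℝ (ψ t) x = cutoff (r ^ 2) (t - t₀) • fderiv ℝ (cutoff r) (x - x₀) ∧
    (Δ (ψ t)) x = cutoff (r ^ 2) (t - t₀) * (Δ (cutoff (E := EuclideanSpace ℝ (Fin 3)) r)) (x - x₀) := by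
  have hψt : (fun s => ψ s x) = fun s => cutoff (r ^ 2) (s - t₀) * cutoff r (x - x₀) := funext fun s => hψ s x
  have hψx : ψ t = fun y => cutoff (r ^ 2) (t - t₀) * cutoff r (y - x₀) := funext fun y => hψ t y
  refine ⟨?_, ?_, ?_⟩
  · rw [hψt, deriv_mul_const_field, deriv_comp_sub_const]
  · rw [hψx]
    have hd : DifferentiableAt ℝ (fun y : EuclideanSpace ℝ (Fin 3) => cutoff r (y - x₀)) x :=
      ((contDiff_cutoff (n := 1) r).differentiable one_ne_zero).differentiableAt.comp x
        (differentiableAt_id.sub_const x₀)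
    rw [fderiv_const_mul hd (cutoff (r ^ 2) (t - t₀))]
    have e : fderiv ℝ (fun y : EuclideanSpace ℝ (Fin 3) => cutoff r (y - x₀)) x = fderiv ℝ (cutoff r) (x - x₀) := by
      have := fderiv_comp_add_right (𝕜 := ℝ) (f := cutoff (E := EuclideanSpace ℝ (Fin 3)) r) (x := x) (-x₀)
      simpa only [sub_eq_add_neg] using this
    rw [e]
  · rw [hψx]
    have hc2 : ContDiff ℝ 2 (fun y : EuclideanSpace ℝ (Fin 3) => cutoff r (y - x₀)) :=
      (contDiff_cutoff r).comp (contDiff_id.sub contDiff_const)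
    have e1 : (fun y : EuclideanSpace ℝ (Fin 3) => cutoff (r ^ 2) (t - t₀) * cutoff r (y - x₀)) =
        cutoff (r ^ 2) (t - t₀) • fun y : EuclideanSpace ℝ (Fin 3) => cutoff r (y - x₀) := by
      funext y; simp [smul_eq_mul]
    rw [e1, InnerProductSpace.laplacian_smul _ hc2.contDiffAt, smul_eq_mul]
    have e2 : (Δ (fun y : EuclideanSpace ℝ (Fin 3) => cutoff r (y - x₀))) x =
        (Δ (cutoff (E := EuclideanSpace ℝ (Fin 3)) r)) (x - x₀) := by
      have := laplacian_comp_add_const (cutoff (E := EuclideanSpace ℝ (Fin 3)) r) (-x₀) x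
      simpa only [sub_eq_add_neg] using this
    rw [e2]

/-- **Continuity of the derivative fields of a parabolic bump** (products of continuous
functions, by `parabolicBump_formulas`). [folklore] -/
theorem parabolicBump_continuous_derivs {r t₀ : ℝ} {x₀ : EuclideanSpace ℝ (Fin 3)}
    {ψ : ℝ → EuclideanSpace ℝ (Fin 3) → ℝ}
    (hψ : ∀ t x, ψ t x = cutoff (r ^ 2) (t - t₀) * cutoff r (x - x₀)) :
    Continuous (fun z : ℝ × EuclideanSpace ℝ (Fin 3) => deriv (fun s => ψ s z.2) z.1) ∧
    Continuous (fun z : ℝ × EuclideanSpace ℝ (Fin 3) => fderiv ℝ (ψ z.1) z.2) ∧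
    Continuous (fun z : ℝ × EuclideanSpace ℝ (Fin 3) => (Δ (ψ z.1)) z.2) := by
  have hct : Continuous fun z : ℝ × EuclideanSpace ℝ (Fin 3) => cutoff (r ^ 2) (z.1 - t₀) :=
    (contDiff_cutoff (n := 0) (r ^ 2)).continuous.comp (continuous_fst.sub continuous_const)
  have hcx : Continuous fun z : ℝ × EuclideanSpace ℝ (Fin 3) => cutoff r (z.2 - x₀) :=
    (contDiff_cutoff (n := 0) r).continuous.comp (continuous_snd.sub continuous_const)
  have hdt : Continuous fun z : ℝ × EuclideanSpace ℝ (Fin 3) => deriv (cutoff (r ^ 2)) (z.1 - t₀) :=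
    ((contDiff_cutoff (n := 1) (r ^ 2)).continuous_deriv le_rfl).comp (continuous_fst.sub continuous_const)
  have hdx : Continuous fun z : ℝ × EuclideanSpace ℝ (Fin 3) => fderiv ℝ (cutoff r) (z.2 - x₀) :=
    ((contDiff_cutoff (n := 1) r).continuous_fderiv one_ne_zero).comp (continuous_snd.sub continuous_const)
  have hdl : Continuous fun z : ℝ × EuclideanSpace ℝ (Fin 3) => (Δ (cutoff (E := EuclideanSpace ℝ (Fin 3)) r)) (z.2 - x₀) :=
    (continuous_laplacian (contDiff_cutoff r)).comp (continuous_snd.sub continuous_const)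
  refine ⟨?_, ?_, ?_⟩
  · have e : (fun z : ℝ × EuclideanSpace ℝ (Fin 3) => deriv (fun s => ψ s z.2) z.1) =
        fun z => deriv (cutoff (r ^ 2)) (z.1 - t₀) * cutoff r (z.2 - x₀) :=
      funext fun z => (parabolicBump_formulas hψ z.1 z.2).1
    rw [e]; exact hdt.mul hcx
  · have e : (fun z : ℝ × EuclideanSpace ℝ (Fin 3) => fderiv ℝ (ψ z.1) z.2) =
        fun z => cutoff (r ^ 2) (z.1 - t₀) • fderiv ℝ (cutoff r) (z.2 - x₀) :=
      funext fun z => (parabolicBump_formulas hψ z.1 z.2).2.1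
    rw [e]; exact hct.smul hdx
  · have e : (fun z : ℝ × EuclideanSpace ℝ (Fin 3) => (Δ (ψ z.1)) z.2) =
        fun z => cutoff (r ^ 2) (z.1 - t₀) * (Δ (cutoff (E := EuclideanSpace ℝ (Fin 3)) r)) (z.2 - x₀) :=
      funext fun z => (parabolicBump_formulas hψ z.1 z.2).2.2
    rw [e]; exact hct.mul hdl

/-- **The derivative fields of a parabolic bump vanish off the box**
`[t₀ - 2r², t₀ + 2r²] × B̄(x₀, 2r)` (each formula carries a factor `cutoff` vanishing there, or the
derivative of `cutoff (r²)`, which vanishes where the cut-off is locally constant). [folklore] -/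
theorem parabolicBump_derivs_eq_zero {r t₀ : ℝ} {x₀ : EuclideanSpace ℝ (Fin 3)} (hr : 0 < r)
    {ψ : ℝ → EuclideanSpace ℝ (Fin 3) → ℝ}
    (hψ : ∀ t x, ψ t x = cutoff (r ^ 2) (t - t₀) * cutoff r (x - x₀)) (t : ℝ) (x : EuclideanSpace ℝ (Fin 3))
    (h : (t, x) ∉ Icc (t₀ - 2 * r ^ 2) (t₀ + 2 * r ^ 2) ×ˢ closedBall x₀ (2 * r)) :
    ψ t x = 0 ∧ deriv (fun s => ψ s x) t = 0 ∧ fderiv ℝ (ψ t) x = 0 ∧ (Δ (ψ t)) x = 0 := by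
  have hr2 : 0 < r ^ 2 := by positivity
  obtain ⟨e1, e2, e3⟩ := parabolicBump_formulas hψ t x
  rw [hψ, e1, e2, e3]
  rw [mem_prod, mem_Icc, mem_closedBall, dist_eq_norm, not_and_or] at h
  rcases h with h | h
  · -- outside the time window: `cutoff (r²)` is locally zero near `t - t₀`
    have hfar : 2 * r ^ 2 < |t - t₀| := by
      rcases not_and_or.1 h with h' | h'
      · rw [abs_of_neg (by linarith)]; linarith
      · rw [abs_of_pos (by linarith)]; linarith
    have h0 : cutoff (r ^ 2) (t - t₀) = 0 := cutoff_eq_zero hr2 (by rw [Real.norm_eq_abs]; linarith)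
    have hev : cutoff (E := ℝ) (r ^ 2) =ᶠ[𝓝 (t - t₀)] fun _ => (0 : ℝ) := by
      have ho : IsOpen {s : ℝ | 2 * r ^ 2 < |s|} := isOpen_lt continuous_const continuous_abs
      filter_upwards [ho.mem_nhds hfar] with s hs
      exact cutoff_eq_zero hr2 (by rw [Real.norm_eq_abs]; linarith [mem_setOf.1 hs])
    have hd0 : deriv (cutoff (E := ℝ) (r ^ 2)) (t - t₀) = 0 := by rw [hev.deriv_eq, deriv_const]
    simp [h0, hd0]
  · -- outside the ball: `cutoff r` is locally zero near `x - x₀`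
    have hfar : 2 * r < ‖x - x₀‖ := not_le.1 h
    have h0 : cutoff r (x - x₀) = 0 := cutoff_eq_zero hr hfar.le
    have hev : cutoff (E := EuclideanSpace ℝ (Fin 3)) r =ᶠ[𝓝 (x - x₀)] fun _ => (0 : ℝ) := by
      have ho : IsOpen {y : EuclideanSpace ℝ (Fin 3) | 2 * r < ‖y‖} := isOpen_lt continuous_const continuous_norm
      filter_upwards [ho.mem_nhds hfar] with y hy
      exact cutoff_eq_zero hr (le_of_lt (mem_setOf.1 hy))
    have hd0 : fderiv ℝ (cutoff (E := EuclideanSpace ℝ (Fin 3)) r) (x - x₀) = 0 := by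
      rw [hev.fderiv_eq]; exact fderiv_const_apply _
    have hl0 : (Δ (cutoff (E := EuclideanSpace ℝ (Fin 3)) r)) (x - x₀) = 0 := by
      rw [(InnerProductSpace.laplacian_congr_nhds hev).eq_of_nhds]
      refine laplacian_eq_zero_of_notMem_tsupport ?_
      have : tsupport (fun _ : EuclideanSpace ℝ (Fin 3) => (0 : ℝ)) = ∅ := by
        rw [tsupport_eq_empty_iff]; rfl
      rw [this]; exact notMem_empty _
    simp [h0, hd0, hl0]

/-! ### The parabolic box and its measures -/

/-- A coordinate is bounded by the Euclidean norm on `ℝ³`. [folklore] -/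
theorem abs_apply_le_norm_fin3 (v : EuclideanSpace ℝ (Fin 3)) (i : Fin 3) : |v i| ≤ ‖v‖ := by
  -- adapted from Literature/Analysis/FluidPDE/AxisymBiotSavartRadialBound.lean (`abs_coord_le_norm_r3`)
  rw [EuclideanSpace.norm_eq, ← Real.sqrt_sq_eq_abs]
  refine Real.sqrt_le_sqrt ?_
  have h := Finset.single_le_sum (f := fun j : Fin 3 => ‖v j‖ ^ 2) (fun j _ => sq_nonneg _)
    (Finset.mem_univ i)
  simpa only [Real.norm_eq_abs, sq_abs] using h

/-- **Volume of the parabolic box** `[t₀ - 2r², t₀ + 2r²] × B̄(x₀, 2r)`: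
`4r² · (4π/3)(2r)³ = (128π/3) r⁵ ≤ 135 r⁵`. [folklore] -/
theorem volume_parabolicBox_le {r : ℝ} (hr : 0 < r) (t₀ : ℝ) (x₀ : EuclideanSpace ℝ (Fin 3)) :
    volume (Icc (t₀ - 2 * r ^ 2) (t₀ + 2 * r ^ 2) ×ˢ closedBall x₀ (2 * r)) ≤ ENNReal.ofReal (135 * r ^ 5) := by
  rw [Measure.volume_eq_prod, Measure.prod_prod, Real.volume_Icc, EuclideanSpace.volume_closedBall_fin_three,
    ← ENNReal.ofReal_pow (by positivity), ← ENNReal.ofReal_mul (by positivity),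
    ← ENNReal.ofReal_mul (by nlinarith)]
  refine ENNReal.ofReal_le_ofReal ?_
  have hπ : Real.pi < 3.15 := Real.pi_lt_d2
  have h5 : 0 < r ^ 5 := by positivity
  have e : (t₀ + 2 * r ^ 2 - (t₀ - 2 * r ^ 2)) * ((2 * r) ^ 3 * (Real.pi * 4 / 3)) = (128 / 3 * Real.pi) * r ^ 5 := by ring
  rw [e]
  nlinarith

/-- **Axis trace of the parabolic box**: the set of `(t, x₃)` with `(t, (0,0,x₃))` in the box has
plane measure `≤ 4r² · 4r = 16 r³`. [folklore] -/
theorem volume_axisTrace_parabolicBox_le (r t₀ : ℝ) (x₀ : EuclideanSpace ℝ (Fin 3)) :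
    volume {p : ℝ × ℝ | ((p.1, meridianPoint (0, p.2)) : ℝ × EuclideanSpace ℝ (Fin 3)) ∈
      Icc (t₀ - 2 * r ^ 2) (t₀ + 2 * r ^ 2) ×ˢ closedBall x₀ (2 * r)} ≤ ENNReal.ofReal (16 * r ^ 3) := by
  have hsub : {p : ℝ × ℝ | ((p.1, meridianPoint (0, p.2)) : ℝ × EuclideanSpace ℝ (Fin 3)) ∈
      Icc (t₀ - 2 * r ^ 2) (t₀ + 2 * r ^ 2) ×ˢ closedBall x₀ (2 * r)} ⊆
      Icc (t₀ - 2 * r ^ 2) (t₀ + 2 * r ^ 2) ×ˢ Icc (x₀ 2 - 2 * r) (x₀ 2 + 2 * r) := by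
    rintro ⟨t, s⟩ ⟨ht, hs⟩
    refine ⟨ht, ?_⟩
    rw [mem_closedBall, dist_eq_norm] at hs
    have hcoord : |(meridianPoint (0, s) - x₀) 2| ≤ ‖meridianPoint (0, s) - x₀‖ :=
      abs_apply_le_norm_fin3 _ 2
    have h2 : |s - x₀ 2| ≤ 2 * r := by
      have e : (meridianPoint (0, s) - x₀) 2 = s - x₀ 2 := by simp
      rw [← e]; exact hcoord.trans hs
    rw [abs_le] at h2
    exact ⟨by linarith, by linarith⟩
  refine (measure_mono hsub).trans ?_
  rw [Measure.volume_eq_prod, Measure.prod_prod, Real.volume_Icc, Real.volume_Icc,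
    ← ENNReal.ofReal_mul (by nlinarith)]
  exact ENNReal.ofReal_le_ofReal (le_of_eq (by ring))

/-- **Lebesgue integral over the box of a function of the space variable** (Tonelli):
`∫∫_{I × B} g(x) = |I| · ∫_B g`. [folklore] -/
theorem lintegral_parabolicBox_snd {r : ℝ} (t₀ : ℝ) (x₀ : EuclideanSpace ℝ (Fin 3))
    {g : EuclideanSpace ℝ (Fin 3) → ℝ≥0∞} (hg : Measurable g) :
    ∫⁻ z in Icc (t₀ - 2 * r ^ 2) (t₀ + 2 * r ^ 2) ×ˢ closedBall x₀ (2 * r), g z.2 =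
      ENNReal.ofReal (4 * r ^ 2) * ∫⁻ x in closedBall x₀ (2 * r), g x := by
  rw [Measure.volume_eq_prod, ← Measure.prod_restrict]
  have e : (fun z : ℝ × EuclideanSpace ℝ (Fin 3) => g z.2) =
      fun z => (fun _ : ℝ => (1 : ℝ≥0∞)) z.1 * g z.2 := by
    funext z; simp
  rw [e, lintegral_prod_mul aemeasurable_const hg.aemeasurable, lintegral_const, Measure.restrict_apply_univ,
    Real.volume_Icc, one_mul]
  congr 1
  congr 1; ring

/-- **The singular drift integrates over the parabolic box**: `∫∫_box ϱ⁻¹ ≤ C_ax r⁴` for an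
absolute `C_ax` (time length `4r²` times `∫_{B(x₀,3r)} ϱ⁻¹ ≤ C (3r)²`,
`lintegral_inv_cylRadius_rpow_ball_le` with `q = 1`). [cite: NazarovUraltseva2012, §4, b̂ ∈ L_{q,∞,loc}, q < 2] -/
theorem exists_lintegral_inv_cylRadius_parabolicBox_le : ∃ C : ℝ, 0 ≤ C ∧
    ∀ (r t₀ : ℝ) (x₀ : EuclideanSpace ℝ (Fin 3)), 0 < r →
      ∫⁻ z in Icc (t₀ - 2 * r ^ 2) (t₀ + 2 * r ^ 2) ×ˢ closedBall x₀ (2 * r),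
        ENNReal.ofReal ((cylRadius z.2)⁻¹) ≤ ENNReal.ofReal (C * r ^ 4) := by
  obtain ⟨C, hC⟩ := lintegral_inv_cylRadius_rpow_ball_le 1 zero_le_one one_lt_two
  refine ⟨36 * C, by positivity, fun r t₀ x₀ hr => ?_⟩
  have hmeas : Measurable fun x : EuclideanSpace ℝ (Fin 3) => ENNReal.ofReal ((cylRadius x)⁻¹) :=
    ENNReal.measurable_ofReal.comp continuous_cylRadius.measurable.inv
  rw [lintegral_parabolicBox_snd t₀ x₀ hmeas]
  have hball : ∫⁻ x in closedBall x₀ (2 * r), ENNReal.ofReal ((cylRadius x)⁻¹) ≤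
      (C : ℝ≥0∞) * ENNReal.ofReal ((3 * r) ^ (3 - 1 : ℝ)) := by
    refine (lintegral_mono_set (closedBall_subset_ball (by linarith : 2 * r < 3 * r))).trans ?_
    have h := hC x₀ (3 * r) (by linarith)
    have e : (fun x : EuclideanSpace ℝ (Fin 3) => ENNReal.ofReal (cylRadius x ^ (-(1 : ℝ)))) =
        fun x => ENNReal.ofReal ((cylRadius x)⁻¹) := by
      funext x; rw [Real.rpow_neg_one]
    rw [e] at h
    exact h
  refine (mul_le_mul' le_rfl hball).trans ?_
  have e3 : (3 * r) ^ (3 - 1 : ℝ) = 9 * r ^ 2 := by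
    rw [show (3 - 1 : ℝ) = (2 : ℕ) by norm_num, Real.rpow_natCast]; ring
  rw [e3, ← ENNReal.ofReal_coe_nnreal, ← ENNReal.ofReal_mul (NNReal.coe_nonneg C),
    ← ENNReal.ofReal_mul (by positivity)]
  exact ENNReal.ofReal_le_ofReal (le_of_eq (by ring))

/-! ### Integral bounds for one bump -/

/-- **A nonnegative function bounded by `c` on the box and vanishing off it integrates to at most
`c · 135 r⁵`** (no measurability needed: `integral_mono_of_nonneg`). [folklore] -/
theorem integral_le_of_le_on_parabolicBox {r : ℝ} (hr : 0 < r) (t₀ : ℝ) (x₀ : EuclideanSpace ℝ (Fin 3))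
    {F : ℝ × EuclideanSpace ℝ (Fin 3) → ℝ} {c : ℝ} (hc : 0 ≤ c) (hF0 : ∀ z, 0 ≤ F z)
    (hFc : ∀ z, F z ≤ c)
    (hFz : ∀ z, z ∉ Icc (t₀ - 2 * r ^ 2) (t₀ + 2 * r ^ 2) ×ˢ closedBall x₀ (2 * r) → F z = 0) :
    ∫ z, F z ≤ c * (135 * r ^ 5) := by
  set Bx : Set (ℝ × EuclideanSpace ℝ (Fin 3)) := Icc (t₀ - 2 * r ^ 2) (t₀ + 2 * r ^ 2) ×ˢ closedBall x₀ (2 * r) with hBx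
  have hBm : MeasurableSet Bx := measurableSet_Icc.prod measurableSet_closedBall
  have hBfin : volume Bx < ∞ := (volume_parabolicBox_le hr t₀ x₀).trans_lt ENNReal.ofReal_lt_top
  have hgi : Integrable (Bx.indicator fun _ : ℝ × EuclideanSpace ℝ (Fin 3) => c) volume :=
    (integrableOn_const (C := c) hBfin.ne).integrable_indicator hBm
  have hle : (fun z => F z) ≤ᵐ[volume] Bx.indicator fun _ => c := Eventually.of_forall fun z => by
    by_cases hz : z ∈ Bx
    · rw [indicator_of_mem hz]; exact hFc z
    · show F z ≤ Bx.indicator (fun _ => c) z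
      rw [indicator_of_notMem hz, hFz z hz]
  refine (integral_mono_of_nonneg (Eventually.of_forall hF0) hgi hle).trans ?_
  rw [integral_indicator_const _ hBm, smul_eq_mul, mul_comm]
  refine mul_le_mul_of_nonneg_left ?_ hc
  rw [measureReal_def]
  have := ENNReal.toReal_mono ENNReal.ofReal_ne_top (volume_parabolicBox_le hr t₀ x₀)
  rwa [ENNReal.toReal_ofReal (by positivity)] at this

/-- **Integrals of the derivative fields of one bump.** For `0 < r < 1`, a bump `ψ` at scale `r`
with the derivative bounds `A` of `exists_parabolicBump_deriv_bounds`: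
`∫∫ |∂ₜψ| ≤ 135 A r`, `∫∫ ‖D_xψ‖ ≤ 135 A r`, `∫∫ |Δ_xψ| ≤ 135 A r` (all `≤ 135 A r³`, and
`r³ ≤ r`). [folklore] -/
theorem integral_bump_derivs_le {r t₀ : ℝ} {x₀ : EuclideanSpace ℝ (Fin 3)} (hr : 0 < r) (hr1 : r < 1)
    {ψ : ℝ → EuclideanSpace ℝ (Fin 3) → ℝ}
    (hψ : ∀ t x, ψ t x = cutoff (r ^ 2) (t - t₀) * cutoff r (x - x₀)) {A : ℝ} (hA0 : 0 ≤ A)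
    (hA : ∀ (t : ℝ) (x : EuclideanSpace ℝ (Fin 3)),
      |deriv (fun s => ψ s x) t| ≤ A / r ^ 2 ∧ ‖fderiv ℝ (ψ t) x‖ ≤ A / r ∧ |(Δ (ψ t)) x| ≤ A / r ^ 2) :
    (∫ z : ℝ × EuclideanSpace ℝ (Fin 3), |deriv (fun s => ψ s z.2) z.1|) ≤ 135 * A * r ∧
    (∫ z : ℝ × EuclideanSpace ℝ (Fin 3), ‖fderiv ℝ (ψ z.1) z.2‖) ≤ 135 * A * r ∧
    (∫ z : ℝ × EuclideanSpace ℝ (Fin 3), |(Δ (ψ z.1)) z.2|) ≤ 135 * A * r := by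
  have hr2 : 0 < r ^ 2 := by positivity
  have hz := parabolicBump_derivs_eq_zero hr hψ
  refine ⟨?_, ?_, ?_⟩
  · have h := integral_le_of_le_on_parabolicBox hr t₀ x₀ (F := fun z : ℝ × EuclideanSpace ℝ (Fin 3) =>
        |deriv (fun s => ψ s z.2) z.1|) (c := A / r ^ 2) (div_nonneg hA0 hr2.le) (fun z => abs_nonneg _)
      (fun z => (hA z.1 z.2).1) (fun z hzB => by rw [(hz z.1 z.2 hzB).2.1, abs_zero])
    refine h.trans ?_
    rw [div_mul_eq_mul_div, div_le_iff₀ hr2]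
    have h5 : r ^ 5 ≤ r ^ 3 := pow_le_pow_of_le_one hr.le hr1.le (by norm_num)
    nlinarith [mul_le_mul_of_nonneg_left h5 hA0]
  · have h := integral_le_of_le_on_parabolicBox hr t₀ x₀ (F := fun z : ℝ × EuclideanSpace ℝ (Fin 3) =>
        ‖fderiv ℝ (ψ z.1) z.2‖) (c := A / r) (div_nonneg hA0 hr.le) (fun z => norm_nonneg _)
      (fun z => (hA z.1 z.2).2.1) (fun z hzB => by rw [(hz z.1 z.2 hzB).2.2.1, norm_zero])
    refine h.trans ?_
    rw [div_mul_eq_mul_div, div_le_iff₀ hr]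
    have h5 : r ^ 5 ≤ r ^ 2 := pow_le_pow_of_le_one hr.le hr1.le (by norm_num)
    nlinarith [mul_le_mul_of_nonneg_left h5 hA0]
  · have h := integral_le_of_le_on_parabolicBox hr t₀ x₀ (F := fun z : ℝ × EuclideanSpace ℝ (Fin 3) =>
        |(Δ (ψ z.1)) z.2|) (c := A / r ^ 2) (div_nonneg hA0 hr2.le) (fun z => abs_nonneg _)
      (fun z => (hA z.1 z.2).2.2) (fun z hzB => by rw [(hz z.1 z.2 hzB).2.2.2, abs_zero])
    refine h.trans ?_
    rw [div_mul_eq_mul_div, div_le_iff₀ hr2]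
    have h5 : r ^ 5 ≤ r ^ 3 := pow_le_pow_of_le_one hr.le hr1.le (by norm_num)
    nlinarith [mul_le_mul_of_nonneg_left h5 hA0]

end Summit.NavierStokesRegularity.NavierStokesRegularity.Theorems.AxisymmetricKatoGlobal.EulerScaling

end
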